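import Summits.BirchSwinnertonDyer.Rank1Residual.O5.CongruenceDefectLawAtNine
import Literature.NumberTheory.EllipticCurves.ModularDegreeQuadraticTwistProofs
import Literature.NumberTheory.EllipticCurves.ModularCurveManinConstantProofs
import HarnessLib

/-!
# O5 — E-O5-CONG under the `(−3)`-TWIST: TWIN (`r(f ⊗ χ) = r(f)` for a level-preserving quadratic twist,
# THEOREM-CANDIDATE with written proof), its KERNEL corollary "the congruence defect jumps by exactly
# one across the III / III* twin" (from the tree's Watkins theorem), the conjectures R-TW and R-FLAT, and
# the pointwise reduction E-O5-CONG ⟺ R-TW ∧ R-FLAT (cell `b2b-bsdres`, lane CLASS-CLOSURE, class O5,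
# seat cc-typer-5 GEN 7 = O5/O6 typer of record; content = o5-r2 GEN 7 `HOME/b2b-bsdres-o5-r2/gen7/
# O5-GEN7.md` (4f98c98b067487ea) §G7-1–G7-3 + `TWIN-PROOF.md` (703f71eb5d2e096e), typing asks N1–N5,
# INBOX 2026-08-21T16:36Z/16:38Z) — TYPED, EVIDENCE-LABELLED, NOTHING ASSERTED; 0 Literature facts

HONEST FRAMING (cell `b2b-bsdres`, run/shared/lean/b2b/bsd-rank1-residual/, verbatim in every file):
the goal of the cell is to DELETE the COMBINATION-SHAPED residual classes of the Birch–Swinnerton-Dyer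
formula for ALL analytic-rank `≤ 1` elliptic curves over `ℚ` — "full BSD formula for every rank `≤ 1`
curve in class `C`" assembled STRICTLY from published theorems — so that the rank-`≤ 1` remainder
becomes exactly the CONSTRUCTION-SHAPED classes, which are TYPED (missing-input `Prop`s), NOT
attempted. This is not "finishing BSD". Lane CLASS-CLOSURE (`CLASS-CLOSURE-PLAN.md` §3.5 O5;
experiment types (1) STATEMENT DISCOVERY and (3) TRANSPORT SEARCH — quadratic twist): research routes;
no claim beyond the stated classes; census output is EVIDENCE, never a Literature fact; nothing is
booked; no mark of `RESIDUAL-MAP.md` moves. Closed unproved `def : Prop` nodes carry `@[conjecture]`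
whatever the docstring grade (cc-lead ⟦gen22⟧ (8)(b) / ⟦gen23⟧ (8)(c)).

## What (o5-r2 GEN 7; notation of `O5/CongruenceDefectLawAtNine.lean`: `r_E = congruenceNumber D.f`,
## `m_E = D.modularDegree` for a minimal-degree parametrisation datum `D`, `e₃(E) := ord₃ r_E − ord₃ m_E`)

* **N1 — M-TW (Watkins' twist degree rule), DEDUP**: the rule `deg φ_E · c_F² = V_p · deg φ_F · c_E²`
  [Watkins 2002 §2.1 p. 491] is, in its ADDITIVE-twin case `V_p = p` (the III/III* twins at `9 ∥ N`), a
  THEOREM OF THE TREE: `ModularForms.ModularParametrizationData.deg_mul_sq_mul_sq_eq_of_quadraticTwist_pStar`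
  / `…_of_abs_u_eq_one` (`Literature/…/ModularDegreeQuadraticTwistProofs.lean`, harvest-2 E63/E64,
  p246074/p246120) — consumed below BY NAME; nothing is re-vendored. The good / multiplicative cases
  (`V₃ = 2(4 − a₃)(4 + a₃)` for `I₀*`, `8` for `Iₙ*`) are in print only (Watkins; Zagier 1985) — NOT minted as
  a fact here (no kernel consumer; offered to harvest-2 as an extension of E64); o5-r2's census M-TW
  (`gen7/twistlaw2.py`, `mtw_500k.tsv.gz` 2095656e28777c26): the exact rational identity holds on
  458 426 / 458 427 optimal curves with `9 ∥ N < 500 000` (one `2²` table artefact), 3-adically on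
  458 427 / 458 427: `jm := ord₃(m_E/c_E²) − ord₃(m_G/c_G²) = +1 (III* 50 731, I₀*-ord 56 349), 0 (I₀*-ss
  29 619, Iₙ* 263 597), −1 (III 58 131)` — EVIDENCE, recorded in the docstrings, not a node.
* **N2 — TWIN `CongruenceNumberTwin` (THEOREM-CANDIDATE, complete elementary proof `TWIN-PROOF.md`)**:
  for an odd prime `p` with `p² ∣ N` and a `p`-PRIMITIVE newform `f` of level `N` (its `χ_{p*}`-twist has
  level `N` again — at `p = 3`: Kodaira III / III* at `3`), `r(f ⊗ χ) = r(f)` (the twisting operator `R_χ`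
  preserves `S₂(Γ₀(N), ℤ)` [Shimura 3.64 / Atkin–Li], fixes congruences coefficientwise, maps `(ℤf)^⊥`
  into `(ℤ f^χ)^⊥` by Atkin–Lehner + strong multiplicity one, and the ARS-admissible moduli are the
  divisors of `r`). EVIDENCE 40/40 twin pairs exact (GEN-6 rows), 30 more pre-registered in CONG3-E1.
  KERNEL COROLLARY (§2, PROVED here from TWIN + the tree's Watkins theorem + `m ∣ r` as hypotheses):
  across an additive twin pair `W` (the `p`-minimal member) / `W'` with `|u| = 1` and Manin constants of
  equal absolute value, **`e_p(W) = e_p(W') + 1`** (`congDefect_twin_eq_add_one`), hence **`ord_p m_W <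
  ord_p r_W`** (`padicValNat_deg_lt_congruenceNumber_of_twin`): at `p = 3`, `3 ∣ r_E/m_E` for EVERY
  optimal curve of type III at `3` with `9 ∥ N` — multiplicity one fails at `(3, I_f)` (ARS Prop 5.9;
  their example 99A1 is the first of 58 131 with `N < 500 000`), no hypothesis on `ρ̄_{E,3}`.
* **N3 — R-TW `CongruenceNumberTwistJumpAtNine` (CONJECTURE)**: for `G` semistable at `3` with
  `ρ̄₃` surjective and `W` a minimal model of `G ⊗ χ₋₃` (conductor `9N_G` resp. `3N_G`):
  `ord₃ r_W − ord₃ r_G = 1` if `G` is good at `3` (supersingular AND ordinary alike), `0` if multiplicative.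
* **N4 — R-FLAT `CongruenceDefectFlatTwinAtNine` (CONJECTURE)**: type III* at `3` (the finite-flat twin),
  `9 ∥ N`, `ρ̄₃` surjective ⟹ `e₃ = 0` (EVIDENCE 40/40 GEN-6 rows; BIK: module defect can vanish without
  freeness).
* **N5 — the reduction (G7-3)**, typed POINTWISE over explicit partner data (§4, PROVED bookkeeping):
  given the pair's degree jump `jm` and ARS Thm 2.1 at the semistable partner (`e₃(G) = 0`), the law's
  value at an `I₀*`/`Iₙ*` curve is EQUIVALENT to R-TW's value at the pair; at a III curve it follows from
  TWIN's corollary + R-FLAT at the twin; at III* it IS R-FLAT. (A global `↔` would need the existence of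
  all partner data — a modularity/optimality input not supplied here; o5-r2: "statement-level … if
  binders permit; else docstring".) Binder ruling (o5-r2 GEN 7): `HasSurjectiveModNGaloisRep 3` KEPT on
  the law, on N3 and on N4; not needed for N1/N2.

## KERNEL STATUS (DOC-ONLY note, cc-typer-5 GEN 9, 2026-08-21; every declaration and statement below is
## byte-identical to p291014; `@[conjecture]` tags untouched — the node stays the obligation, its proof is
## the audit's proof-of-item)

**N2 TWIN `CongruenceNumberTwin` IS A THEOREM OF THE TREE for every odd prime `p`:
`O5.congruenceNumberTwin_holds : CongruenceNumberTwin`** (cross-cell pool hand x11b3-p5 GEN 7, on o5-r2's N2 and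
this seat's "no objection"): `O5/CharTwistPrimeLevel.lean` p294788 (`χ` mod `p` via Mathlib's Jacobi sums; the
level `Λ = Γ₀(N) ∩ Γ₁(p)`, which `[1, u/p; 0, 1]` NORMALISES when `p² ∣ N`) → `O5/CharTwistPrimeIsometry.lean`
p296005 (Petersson ISOMETRY `⟨f ⊗ χ_p, x ⊗ χ_p⟩ = ⟨f, x⟩` for every `p`-DEPLETED `f ∈ S_k(Γ₀(N))`, any prime `p`
with `p² ∣ N`) → `O5/CongruenceNumberTwistPrime.lean` p297342 (`PrimeTwist.congruenceNumber_charTwist`: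
`r(f ⊗ χ_p) = r(f)` for every `p`-depleted `f`; `congruenceNumber_twin_prime` — no conductor / minimality binders;
`congruenceNumberTwin_holds`). The route is NOT the newform-theoretic sketch of `TWIN-PROOF.md` (no Atkin–Lehner /
strong multiplicity one is used) — a Petersson-isometry argument on `p`-depleted forms; the `p = 3` case landed
first (`O5/CharTwistThreeIsometry.lean` p291889, `O5/CongruenceNumberTwistThree.lean` p292663). CONSEQUENCES: the
§2 corollaries below are UNCONDITIONAL with `hT := congruenceNumberTwin_holds` (`congDefect_twin_eq_add_one`,
`padicValNat_deg_lt_congruenceNumber_of_twin`: across every additive `χ_{p*}`-twin pair with `|u| = 1` and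
`|c| = |c′|`, `e_p(W) = e_p(W′) + 1` and `ord_p m_W < ord_p r_W`); at `p = 3` they are restated WITHOUT `hT` in
`O5/CongruenceDefectTwinThree.lean` p292960 (`congDefect_twin_three_eq_add_one`,
`padicValNat_deg_lt_congruenceNumber_twin_three`). So the type-III third of E-O5-CONG (`3 ∣ r_E/m_E` at every
optimal III curve with `9 ∥ N`) rests on Watkins (tree) + `m′ ∣ r′ ≠ 0` (the ARS Thm 2.1 instance) + `|c| = |c′|`
only; the CONJECTURAL content of E-O5-CONG is exactly R-TW (`CongruenceNumberTwistJumpAtNine`, N3) ∧ R-FLAT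
(`CongruenceDefectFlatTwinAtNine`, N4), both untouched `@[conjecture]` nodes. Reading (EVIDENCE wording, o5-r2 /
x11b3-p5 / this seat): "TWIN is a THEOREM for every odd `p`; nothing booked; no mark; not in print per o5-r2's
presearch (ARS 2012 do not treat twists) — a Summits-side theorem, not a Literature fact."

## KERNEL STATUS 2 (DOC-ONLY §4 pointer, cc-typer-5 GEN 10, 2026-08-21; statements byte-identical, tags untouched)

**N1 M-TW is a THEOREM OF THE TREE at EVERY reduction type of the `p`-semistable partner, all odd `p`** (cross-cell
pool item W42, x11b3-p5 GEN 8; harvest-2 GEN 43 and this seat GEN 9: no objection): the good / multiplicative cases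
that the N1 bullet above records as "in print only — NOT minted" are now PROVED, not minted —
`Literature/NumberTheory/EllipticCurves/RankinSeriesTwistEulerFactorProofs.lean` p299118 (one Euler factor of the
Rankin–Selberg series under the twist, `rankinResidue_eq_mul_of_twist`) and
`Literature/NumberTheory/EllipticCurves/ModularDegreeQuadraticTwistSemistableProofs.lean` p299692
(`ModularParametrizationData.deg_mul_sq_mul_sq_eq_of_quadraticTwist_pStar_of_hasGoodReductionAtPrime`:
`D′.deg·D.c²·u² = (p−1)((p+1)² − a_p²)·D.deg·D′.c²`, levels `M` (`p ∤ M`) / `N = p²M`;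
`…_of_hasMultiplicativeReductionAtPrime`: `= (p²−1)·D.deg·D′.c²`, levels `M` (`p ∣ M`) / `N = pM`; `|u| = 1` ℤ-forms).
**The `hjm` input of §4 `law_iff_twistJump_of_jm` is therefore supplied by THEOREMS at `p = 3`**:
`Summits/…/O5/ModularDegreeTwistJumpThree.lean` p300149 (x11b3-p5 GEN 8; it IMPORTS this file, hence is not imported
here — consumers import it) proves `O5.padicValNat_modularDegree_twist_three_of_hasGoodReductionAtPrime` — for `W` GOOD
at `3`, `W′ = C • (W ⊗ χ₋₃)` with `|u(C)| = 1`, data at levels `M` (`3 ∤ M`) and `N = 9M`, `|c| = |c′|`: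
`ord₃ m_{W′} = ord₃ m_W + 1` if `3 ∤ a₃(W)` (ORDINARY, `V₃ ∈ {30, 24}`: `jm = 1` on `I₀*`-ord) and `= ord₃ m_W` if
`3 ∣ a₃(W)` (SUPERSINGULAR, `V₃ ∈ {32, 14}`: `jm = 0` on `I₀*`-ss) — and
`O5.padicValNat_modularDegree_twist_three_of_hasMultiplicativeReductionAtPrime` — `W` MULTIPLICATIVE at `3`, levels `M`
(`3 ∣ M`) / `N = 3M`: `ord₃ m_{W′} = ord₃ m_W` (`V₃ = 8`: `jm = 0` on `Iₙ*`). This is exactly o5-r2's census split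
(`jm = +1`: I₀*-ord 56 349; `0`: I₀*-ss 29 619, Iₙ* 263 597), now a theorem row by row under the two explicit
hypotheses `|u| = 1` and `|c| = |c′|` (Manin constants of the twist pair: no tree theorem; kept explicit, never
hidden). NO node `ModularDegreeTwistJumpAtNine` is typed (GEN 9 decision (ii) stands: the jump law IS a theorem;
§4's binders are fed by name). What stays CONJECTURAL in this file is unchanged: R-TW (N3) and R-FLAT (N4); the
reduction §4 is bookkeeping. Census EVIDENCE; nothing booked; no mark of `RESIDUAL-MAP.md` moves; O5 OPEN.

References: M. Watkins, Experiment. Math. 11 (2002) §2.1 p. 491 [Watkins2002]; A. Agashe, K. Ribet,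
W. Stein (2012) §2.1, Thm 2.1, Prop 5.9 [AgasheRibetStein2012]; G. Shimura, *Introduction to the
arithmetic theory of automorphic functions* Prop. 3.64; Atkin–Li 1978; W.-C. Li 1975 Cor. 3 (strong
multiplicity one); S. Brochard, S. Iyengar, C. Khare, arXiv:2107.06759 Thm 1 [PREPRINT/PUB as recorded by
o5-r2]; `cells/o5o6/TARGETS.md` §O5 o5-r2 GEN 7; `class-closure/O5/TYPED.md` §11.
-/

set_option autoImplicit false

noncomputable section

open scoped Classical

open WeierstrassCurve Summit.BirchSwinnertonDyer.Rank1Residual.Additive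
  Literature.NumberTheory.EllipticCurves.Rank1Residual
  Literature.NumberTheory.EllipticCurves.ModularForms
  Literature.NumberTheory.DiophantineGeometry

namespace Summit.BirchSwinnertonDyer.Rank1Residual.O5

/-- The twisting discriminant `p* = (−1)^{(p−1)/2} p` as a rational number (`−3` at `p = 3`), in the form
used by `ModularDegreeQuadraticTwistProofs`. [folklore] -/
def pStarRat (p : ℕ) : ℚ := (((-1 : ℤ) ^ (p / 2) * p : ℤ) : ℚ)

/-- `p* = −3` at `p = 3`. [folklore] -/
theorem pStarRat_three : pStarRat 3 = -3 := by norm_num [pStarRat]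

/-! ## §1 N2 — TWIN: congruence numbers are invariant under a level-preserving quadratic twist -/

/-- **TWIN `CongruenceNumberTwin` (o5-r2 GEN 7 N2 `CongruenceNumberTwinAtNine` in its general form;
THEOREM-CANDIDATE with a complete elementary proof, `HOME/b2b-bsdres-o5-r2/gen7/TWIN-PROOF.md`
703f71eb5d2e096e; `@[conjecture]` tag by the lane rule until a kernel proof).**  Let `p` be an odd
prime, `W, W'/ℚ` elliptic in globally minimal models with `W'` a model of the quadratic twist
`W ⊗ χ_{p*}`, BOTH of conductor `N` with `p² ∣ N` (so the newform `f` of `W` is `p`-primitive and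
`f ⊗ χ` is the newform of `W'`, again of level `N`; at `p = 3`, `9 ∥ N`: Kodaira III / III* twins),
and `D, D'` parametrisation data at level `N`. Then `r(f ⊗ χ) = r(f)`:
`congruenceNumber D'.f = congruenceNumber D.f`.  Proof (o5-r2): `R_χ(Σ aₙqⁿ) = Σ χ(n)aₙqⁿ` preserves
`S₂(Γ₀(N), ℤ)` (`lcm(N, p²) = N`; Shimura Prop. 3.64 / Atkin–Li), `a_{pk}(f) = 0` so `R_χ² f = f` and
`R_χ f = f ⊗ χ` is new of level `N` iff `f` is `p`-primitive; `R_χ` maps `(ℤf)^⊥` into `(ℤ f^χ)^⊥`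
(Atkin–Lehner decomposition + strong multiplicity one) and preserves congruences `g ≡ f (mod c)`
coefficientwise; ARS-admissible moduli are exactly the divisors of `r` (Lemma 0); hence `r(f) ∣ r(f^χ)`
and symmetrically.  Not found in print (presearch o5-r2: corpus + galaxy, ARS 2012 do not treat twists).
EVIDENCE: 40/40 III/III* twin pairs with `r_E = r_{E'}` exactly in the GEN-6 CONG3 rows; 30 more pairs
pre-registered in CONG3-E1 (kit j135039–44).
**PROVED 2026-08-21 (kernel): `O5.congruenceNumberTwin_holds : CongruenceNumberTwin`** (x11b3-p5 GEN 7,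
`O5/CongruenceNumberTwistPrime.lean` p297342, via the Petersson isometry of the `χ_p`-twist on `p`-depleted forms
— see the module's KERNEL STATUS; the `p = 3` clause earlier as `congruenceNumberTwin_three`, p292663). This
statement is byte-identical; the tag is KEPT as the obligation node of record (its proof is the audit's
proof-of-item) pending a ruling of the o5 planners / cc-lead on proved nodes.
[cite: AgasheRibetStein2012, §2.1 (i)⟺(ii)] [evidence: census cell O5, o5-r2 GEN 6/7: 40/40 twin pairs exact] -/
@[conjecture] def CongruenceNumberTwin : Prop :=
  ∀ (p : ℕ) [Fact p.Prime], p ≠ 2 →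
    ∀ (W W' : WeierstrassCurve ℚ) [W.IsElliptic] [W.IsGloballyMinimal] [W'.IsElliptic]
      [W'.IsGloballyMinimal] (C : VariableChange ℚ), C • W.quadraticTwist (pStarRat p) = W' →
      ∀ (N : ℕ) [NeZero N] (D : ModularParametrizationData W N) (D' : ModularParametrizationData W' N),
        W.conductorNorm ℤ = N → W'.conductorNorm ℤ = N → p ^ 2 ∣ N →
          congruenceNumber D'.f = congruenceNumber D.f

/-! ## §2 KERNEL COROLLARY: the congruence defect jumps by exactly one across an additive twin -/

section TwinJump

variable {p : ℕ} [Fact p.Prime]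
  {W W' : WeierstrassCurve ℚ} [W.IsElliptic] [W.IsGloballyMinimal] [W'.IsElliptic] [W'.IsGloballyMinimal]
  {N : ℕ} [NeZero N]

omit [W.IsGloballyMinimal] [W'.IsGloballyMinimal] in
/-- **Watkins' `V_p = p` read 3-adically (from the TREE theorem, no twist conjecture)**: for an additive
twin pair `W, W' = C • (W ⊗ χ_{p*})` with `|u(C)| = 1` (no re-minimalisation: `W` is the `p`-minimal
member — at `p = 3` the type-III curve, `v₃Δ: 3 ↦ 9`) and Manin constants of equal absolute value,
`ord_p m_{W'} = ord_p m_W + 1`. [cite: Watkins2002, §2.1 (p. 491)] -/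
theorem padicValNat_deg_twin_eq_add_one (hp2 : p ≠ 2) (C : VariableChange ℚ)
    (hW' : C • W.quadraticTwist (pStarRat p) = W') (hu : |(C.u : ℚ)| = 1)
    (hadd : Addv W p) (hadd' : Addv W' p)
    (D : ModularParametrizationData W N) (D' : ModularParametrizationData W' N)
    (hc : D.c.natAbs = D'.c.natAbs) :
    padicValNat p D'.modularDegree = padicValNat p D.modularDegree + 1 := by
  have hp : p.Prime := Fact.out
  have hW0 : ∀ n : ℕ, p ∣ n → W.LFunction n = 0 := fun n hn ↦
    W.LFunction_apply_eq_zero_of_not_good_of_not_mult p hadd.1 hadd.2 hn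
  have hW'0 : ∀ n : ℕ, p ∣ n → W'.LFunction n = 0 := fun n hn ↦
    W'.LFunction_apply_eq_zero_of_not_good_of_not_mult p hadd'.1 hadd'.2 hn
  have hmain := ModularParametrizationData.deg_mul_sq_eq_of_quadraticTwist_pStar_of_abs_u_eq_one
    hp2 C hW' hu hW0 hW'0 D D'
  -- equal Manin constants up to sign, and `c ≠ 0`
  have hcsq : D.c ^ 2 = D'.c ^ 2 := by
    rcases Int.natAbs_eq_natAbs_iff.mp hc with h | h <;> simp [h]
  have hc0 : D.c ≠ 0 := D.maninConstant_ne_zero_holds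
  have hcsq0 : D'.c ^ 2 ≠ 0 := by rw [← hcsq]; exact pow_ne_zero 2 hc0
  have hdeg : (D'.deg : ℤ) = p * D.deg := by
    rw [hcsq] at hmain
    exact mul_right_cancel₀ hcsq0 (by linarith [hmain])
  have hdeg' : D'.deg = p * D.deg := by exact_mod_cast hdeg
  show padicValNat p D'.deg = padicValNat p D.deg + 1
  rw [hdeg', padicValNat.mul hp.ne_zero D.deg_pos.ne', padicValNat_self]
  ring

/-- **`e_p(W) = e_p(W') + 1` across an additive twin** (o5-r2 N2 corollary `congDefect_III_eq_IIIstar_add_one`,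
general odd `p`; in ℕ-safe form `ord_p r_W + ord_p m_{W'} = ord_p r_{W'} + ord_p m_W + 1`): from TWIN
(`r_{W'} = r_W`, hypothesis) and Watkins (`ord_p m_{W'} = ord_p m_W + 1`, tree). [folklore] -/
theorem congDefect_twin_eq_add_one (hT : CongruenceNumberTwin) (hp2 : p ≠ 2) (C : VariableChange ℚ)
    (hW' : C • W.quadraticTwist (pStarRat p) = W') (hu : |(C.u : ℚ)| = 1)
    (hadd : Addv W p) (hadd' : Addv W' p)
    (D : ModularParametrizationData W N) (D' : ModularParametrizationData W' N)
    (hN : W.conductorNorm ℤ = N) (hN' : W'.conductorNorm ℤ = N) (hpN : p ^ 2 ∣ N)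
    (hc : D.c.natAbs = D'.c.natAbs) :
    padicValNat p (congruenceNumber D.f) + padicValNat p D'.modularDegree =
      padicValNat p (congruenceNumber D'.f) + padicValNat p D.modularDegree + 1 := by
  have hr : congruenceNumber D'.f = congruenceNumber D.f := hT p hp2 W W' C hW' N D D' hN hN' hpN
  rw [hr, padicValNat_deg_twin_eq_add_one hp2 C hW' hu hadd hadd' D D' hc]
  ring

/-- **`ord_p m_W < ord_p r_W` on the `p`-minimal twin** (o5-r2 N2 corollary `three_dvd_congRatio_of_typeIII`:
at `p = 3`, `3 ∣ r_E/m_E` for every optimal type-III curve at `9 ∥ N`, hence multiplicity one FAILS at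
`(3, I_f)` by ARS Prop. 5.9): given TWIN, Watkins (tree) and `m_{W'} ∣ r_{W'} ≠ 0` at the twin (ARS Thm 2.1
— the tree's cited `modularDegree_dvd_congruenceNumber`, supplied here as the instance `h21'`).
[cite: AgasheRibetStein2012, Thm. 2.1 and Prop. 5.9] -/
theorem padicValNat_deg_lt_congruenceNumber_of_twin (hT : CongruenceNumberTwin) (hp2 : p ≠ 2)
    (C : VariableChange ℚ) (hW' : C • W.quadraticTwist (pStarRat p) = W') (hu : |(C.u : ℚ)| = 1)
    (hadd : Addv W p) (hadd' : Addv W' p)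
    (D : ModularParametrizationData W N) (D' : ModularParametrizationData W' N)
    (hN : W.conductorNorm ℤ = N) (hN' : W'.conductorNorm ℤ = N) (hpN : p ^ 2 ∣ N)
    (hc : D.c.natAbs = D'.c.natAbs)
    (h21' : D'.modularDegree ∣ congruenceNumber D'.f) (hr' : congruenceNumber D'.f ≠ 0) :
    padicValNat p D.modularDegree < padicValNat p (congruenceNumber D.f) := by
  have hp : p.Prime := Fact.out
  have hjump := congDefect_twin_eq_add_one hT hp2 C hW' hu hadd hadd' D D' hN hN' hpN hc
  -- `m' ∣ r'`, `r' ≠ 0` ⟹ `ord_p m' ≤ ord_p r'`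
  obtain ⟨k, hk⟩ := h21'
  have hm0 : D'.modularDegree ≠ 0 := fun h ↦ hr' (by rw [hk, h, zero_mul])
  have hk0 : k ≠ 0 := fun h ↦ hr' (by rw [hk, h, mul_zero])
  have hle : padicValNat p D'.modularDegree ≤ padicValNat p (congruenceNumber D'.f) := by
    rw [hk, padicValNat.mul hm0 hk0]
    exact Nat.le_add_right _ _
  omega

end TwinJump

/-! ## §3 N3 (R-TW) and N4 (R-FLAT): the two conjectural halves of E-O5-CONG at `9 ∥ N` -/

/-- **R-TW `CongruenceNumberTwistJumpAtNine` (o5-r2 GEN 7 N3; CONJECTURE, census-derived).**  Let `G/ℚ`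
be SEMISTABLE at `3` (good or multiplicative), globally minimal, of conductor `M`, and `W` a globally
minimal model of the twist `G ⊗ χ₋₃`, of conductor `N` with `f₃(W) = 2` (`N = 9M` resp. `3M`: Kodaira
`I₀*` resp. `Iₙ*` at `3`) and `ρ̄_{W,3}` surjective; `D_G, D_W` parametrisation data at the conductors. Then
**`ord₃ r_W = ord₃ r_G + 1` if `G` is GOOD at `3` (supersingular and ordinary alike), `ord₃ r_W = ord₃ r_G`
if `G` is MULTIPLICATIVE at `3`** — the congruence number gains exactly one `3` under the twist into
`9 ∥ N` from a good prime, none from a multiplicative one (whereas the degree gains `ord₃ V₃ =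
ord₃(2(16 − a₃²))` = `1` for ordinary, `0` for supersingular `G`, and `0` for multiplicative — Watkins;
this asymmetry IS E-O5-CONG on `I₀*`/`Iₙ*`, §4).  One-way transport `r_G ∣ r_W` is elementary
(TWIN-PROOF Remark) — and a KERNEL THEOREM since 2026-08-21: `O5.congruenceNumber_dvd_twist_three` /
`O5.padicValNat_congruenceNumber_le_twist_three` (`ord₃ r_G ≤ ord₃ r_W`; x11b3-p5 GEN 10/12,
`O5/CongruenceNumberTwistTransport.lean` p307229 on `O5/CharTwistOrthogonalityTransport.lean` p303745: `r(F) ∣ r(F ⊗ ψ)`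
across levels `M ∣ N`, `9 ∣ N`, by character-twist orthogonality; cc-typer-5 GEN 10 restamp 3, statements here
byte-identical). The EXACT jump (`+1` good / `0` multiplicative) stays the node.  Why it might fail: it is equivalent (given M-TW and ARS 2.1 at `G`) to E-O5-CONG on
the `I₀*`/`Iₙ*` rows, whose only support is the census; a type-resolved congruence-module computation
(o5-r2's CONG3-T) would locate the extra `3`.  EVIDENCE: = E-O5-CONG on the 295 GEN-6 rows (`I₀*-ss` μ/e₃
rows + `I₀*-ord` + `Iₙ*`, 0 exceptions); DIRECT r-side test pre-registered in CONG3-E1 (partner rows: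
`+1` predicted on 43 good, `0` on 98 multiplicative; kit j135039–44, pending at typing time).
[evidence: census cell O5, o5-r2 GEN 6 CONG3 295/295 (via M-TW); CONG3-E1 partner rows pre-registered ef156a16a9b9d31c]
[cite: AgasheRibetStein2012, Thm. 2.1] [cite: Watkins2002, §2.1 (p. 491)] -/
@[conjecture] def CongruenceNumberTwistJumpAtNine : Prop :=
  ∀ (G W : WeierstrassCurve ℚ) [G.IsElliptic] [G.IsGloballyMinimal] [W.IsElliptic] [W.IsGloballyMinimal]
    (C : VariableChange ℚ), C • G.quadraticTwist (-3) = W →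
    ∀ (M N : ℕ) [NeZero M] [NeZero N] (DG : ModularParametrizationData G M)
      (DW : ModularParametrizationData W N),
      G.conductorNorm ℤ = M → W.conductorNorm ℤ = N →
      (G.HasGoodReductionAtPrime 3 ∨ G.HasMultiplicativeReductionAtPrime 3) →
      CondExpTwo W 3 → W.HasSurjectiveModNGaloisRep 3 →
        padicValNat 3 (congruenceNumber DW.f) =
          padicValNat 3 (congruenceNumber DG.f) + (if G.HasGoodReductionAtPrime 3 then 1 else 0)

/-- **R-FLAT `CongruenceDefectFlatTwinAtNine` (o5-r2 GEN 7 N4; CONJECTURE, census-mined — the ONE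
conjectural statement of E-O5-CONG at `e = 4`).**  For an optimal `W` (minimal-degree datum `D` at its
conductor `N`) with `f₃ = 2`, `ρ̄_{W,3}` surjective and Kodaira type III* at `3` (the FINITE-FLAT member of
the twin pair, `v₃Δ = 9`): `ord₃ r_W = ord₃ m_W` ("the flat twin is balanced", `e₃ = 0`).  In
Brochard–Iyengar–Khare's language: the module defect of `H₁(X₀(N), ℤ₃)^±_𝔪` at `𝔭_f` vanishes although
freeness / multiplicity one fails (`μ = 2` on III*, o5-r2 GEN 5/6) — III* is a natural family of exactly
that.  Why it might fail: no structural reason known for `e₃(III*) = 0` beyond the census; a prover's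
road (o5-r2): BKM's `End_𝕋 H = 𝕋` criterion at `𝔪_{III*}` via Kisin potentially-Barsotti–Tate patching
at `p = 3`.  EVIDENCE: III* `e₃ = 0` on 40/40 GEN-6 CONG3 rows (`μ = 2` on all); 29 III* rows
pre-registered in CONG3-E1.  It is the III* clause of `CongruenceDefectLawAtNine`
(`¬ CongDefectKindThree` there; `padicValNat_congruenceNumber_eq_of_law_of_not_kind`).
[evidence: census cell O5, o5-r2 GEN 6 CONG3: III* 40/40 e₃ = 0] [cite: AgasheRibetStein2012, Thm. 2.1 and Conj. 2.2] -/
@[conjecture] def CongruenceDefectFlatTwinAtNine : Prop :=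
  ∀ (W : WeierstrassCurve ℚ) [W.IsElliptic] [W.IsGloballyMinimal] (N : ℕ) [NeZero N]
    (D : ModularParametrizationData W N),
    (∀ (W' : WeierstrassCurve ℚ) [W'.IsElliptic] (D' : ModularParametrizationData W' N),
        D'.f = D.f → D.modularDegree ≤ D'.modularDegree) →
    W.conductorNorm ℤ = N → CondExpTwo W 3 → W.HasSurjectiveModNGaloisRep 3 →
    W.kodairaSymbolAt (placeOf 3) = .IIIstar →
      padicValNat 3 (congruenceNumber D.f) = padicValNat 3 D.modularDegree

/-! ## §4 N5 — the reduction E-O5-CONG ⟺ R-TW ∧ R-FLAT, pointwise over explicit partner data (PROVED) -/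

section Reduction

/-- **(I₀*/Iₙ* rows) E-O5-CONG at `W` ⟺ R-TW at the pair `(G, W)`, given the pair's degree jump `jm`
and `e₃(G) = 0`** (pure bookkeeping; o5-r2 G7-3).  Inputs as NUMBERS on the pair: `hjm : ord₃ m_W =
ord₃ m_G + jm` (Watkins/M-TW: `jm = 1` for `I₀*`-ord, `0` for `I₀*`-ss and `Iₙ*`), `hG : ord₃ r_G = ord₃ m_G`
(ARS Thm 2.1 at the semistable `G`, `9 ∤ M`: the tree's cited `padicValNat_congruenceNumber_eq_of_not_sq_dvd`),
the law's predicted defect `d ∈ {0,1}` at `W` (`1` iff `I₀*`-ss) and R-TW's predicted jump `t` (`1` iff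
`G` good): then `d + jm = t` is exactly the consistency `(I₀*-ss) 1+0 = 1, (I₀*-ord) 0+1 = 1, (Iₙ*) 0+0 = 0`,
and under it `ord₃ r_W = ord₃ m_W + d ↔ ord₃ r_W = ord₃ r_G + t`.
KERNEL POINTER (cc-typer-5 GEN 10, doc-only): `hjm` is a THEOREM of the tree on every row, under `|u| = 1` and
`|c| = |c′|` — `O5.padicValNat_modularDegree_twist_three_of_hasGoodReductionAtPrime` (`jm = 1` iff `3 ∤ a₃(G)`,
else `0`) and `O5.padicValNat_modularDegree_twist_three_of_hasMultiplicativeReductionAtPrime` (`jm = 0`) of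
`O5/ModularDegreeTwistJumpThree.lean` (x11b3-p5 GEN 8, p300149; that file imports this one); `hG` is the cited
ARS Thm 2.1 instance as before. [folklore] -/
theorem law_iff_twistJump_of_jm {rW mW rG mG jm d t : ℕ} (hjm : mW = mG + jm) (hG : rG = mG)
    (hdt : d + jm = t) : (rW = mW + d ↔ rW = rG + t) := by
  subst hG; omega

/-- **(III rows) E-O5-CONG at a type-III `W` from TWIN's corollary + R-FLAT at the twin**: if
`ord₃ r_W + ord₃ m_{W'} = ord₃ r_{W'} + ord₃ m_W + 1` (`congDefect_twin_eq_add_one`) and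
`ord₃ r_{W'} = ord₃ m_{W'}` (R-FLAT at the III* twin `W'`), then `ord₃ r_W = ord₃ m_W + 1` — the law's value
(`CongDefectKindThree` holds at III). [folklore] -/
theorem law_at_III_of_twin_of_flat {rW mW rW' mW' : ℕ} (hjump : rW + mW' = rW' + mW + 1)
    (hflat : rW' = mW') : rW = mW + 1 := by
  omega

/-- **(III* rows) the law's value IS R-FLAT** (`¬ CongDefectKindThree` at III*; cf.
`padicValNat_congruenceNumber_eq_of_law_of_not_kind`): E-O5-CONG ⟹ R-FLAT on every III* row that is
not also of kind `(G)∧ss` (automatic: III* has `e = 4`). [folklore] -/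
theorem flatTwin_of_law (hL : CongruenceDefectLawAtNine)
    (W : WeierstrassCurve ℚ) [W.IsElliptic] [W.IsGloballyMinimal] (N : ℕ) [NeZero N]
    (D : ModularParametrizationData W N)
    (hmin : ∀ (W' : WeierstrassCurve ℚ) [W'.IsElliptic] (D' : ModularParametrizationData W' N),
      D'.f = D.f → D.modularDegree ≤ D'.modularDegree)
    (hN : W.conductorNorm ℤ = N) (hf : CondExpTwo W 3) (hρ : W.HasSurjectiveModNGaloisRep 3)
    (hk : ¬ CongDefectKindThree W) :
    padicValNat 3 (congruenceNumber D.f) = padicValNat 3 D.modularDegree :=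
  padicValNat_congruenceNumber_eq_of_law_of_not_kind D hmin hN hf hρ hL hk

end Reduction

end Summit.BirchSwinnertonDyer.Rank1Residual.O5

end
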